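import Literature.NumberTheory.Automorphic.CoefficientOrbitalFunctionEllipticReading          -- ★-to-be (LH5-p02 (g10) FILE 1 «ELL-READING CORE»): `eq_mul_integral_conj_of_forall_setIntegral_eq`
import Literature.NumberTheory.Automorphic.ConjugationProperOnEllipticNeighbourhoodLocal       -- ★-to-be (LH5-p02 (g10) FILE 2∕3 «(UC)-G» at `(cmDatum L N H).Local v`): `exists_isOpen_isCompact_forall_apply_conj_eq_zero_cmDatum_local_of_isCompact_centralizer`
import Summits.HodgeConjecture.HodgeConjecture.Theorems.F0P3cStCharTSEllCartanCompact          -- ★ «ELL-CARTAN-COMPACT»: `isCompact_centralizer_of_not_mem_hyperbolicSet` (`Z(γ₀)` compact for `γ₀ ∈ G^r ∖ Ω`)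
import Summits.HodgeConjecture.HodgeConjecture.Theorems.F0P3cStCharTSPsVanish                  -- ★ «PS-VANISH» (idioms + brings ★ CasselmanCap `integral_indicator_mul_eq_of_eqOn`, ★ `totallyDisconnectedSpace_cmDatum_local`, ★ Ch12Sec5Defs, ★ `isLocSmooth_indicator`)
import Literature.NumberTheory.Automorphic.ArchTorusOrbitalFunctionAtPoint                     -- ★ `OrbitalMeasureFamily.IsCanonical.classOrbitalIntegral_mk_eq_integral_conj_of_isCompact` (compact centraliser ⇒ `Φ(⟦γ⟧, a) = ∫_G a(gγg⁻¹) dν`)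
import Literature.NumberTheory.Automorphic.AdmissibleInvariantFormSchur                        -- ★ E2-1 A: `IsSupercuspidal.hasCompactSupport_sesqForm_apply_apply`, `continuous_sesqForm_apply_apply`
import Literature.NumberTheory.Automorphic.SmoothRepresentationLocallyConstant                 -- ★ `Representation.IsSmooth.isLocallyConstant_apply`
import Literature.NumberTheory.Automorphic.AdicCompletionCompact                               -- ★ `properSpace_adicCompletion`, `locallyCompactSpace_adicCompletion`
import Literature.NumberTheory.Automorphic.SupercuspidalCoefficientTrace                       -- ★ p852832 E2-2 (T2) `Representation.IsSupercuspidal.integral_integral_mul_sesqForm_conj_eq` (LH5-p04 (g8)); brings ★ E2-1 `integral_norm_sq_sesqForm_pos`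
import Literature.NumberTheory.Automorphic.CMPrincipalSeriesJacquetEvalOne                     -- ★ `nonarchimedeanGroup_unitaryGroupOfForm_local`
import HarnessLib

/-!
# F0 · P3c · line LH6 «StCharTS» — E2-4 «ELL-READING», the DATUM DRESS (FILE 3): at an elliptic regular `γ ∈ G^e` of `U(Φ₃)(L⁺_v)` the orbital integral of a
# supercuspidal matrix coefficient IS the character: `Φ(γ, f_π) = conj χ_π(γ)` [Rogawski1990 §12.6 p. 187; Harish-Chandra 1970 Part V §4 Thm. 12]

Cell `pub/hodgecm-mathlib`, crux H413 = `stmt-HodgeConjecture-24833` (`--supports` lane, helper), route HCCMUnconditional; seat F0P3b-p01 (g23), RULE-20 brick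
under LEAD T14-67∕T14-69 on census HC-SC v1.1 §2 **E2-4** (F0P3a-p02 (g26), its 22:11:52Z spec «FILE 3 = the datum heads at `Gqs L v`»; precedence released by
LH6-p03 (g8) ∕ LH10-p02 (g12)).  THEOREMS ONLY, sorry-free, no definition ∕ instance ∕ notation ∕ named fact; the §12.5 datum `𝔇` is a BINDER (its field
relations enter as `=`∕`↔` hypotheses, road rule §2.1).  HONEST LABEL: HC_CM is proved only modulo the 7 printed citations (2 remaining: hLiu418 =
stmt-HodgeConjecture-24832, h413 = stmt-HodgeConjecture-24833) until rung 0 closes; count-neutral (closes no organ; no leaf edition implied).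

THE MATHEMATICS (print, §12.6 p. 187: «a pseudo-coefficient `f_π` … can be taken to be a matrix coefficient if `π` is supercuspidal»; Harish-Chandra 1970
Part V §4, Theorem 12 `Θ_π = F_Γ` on `G′` with `F_Γ(γ) = d(π) ∫ θ(γ^{x}) dx`).  Let `G = U(Φ₃)(L⁺_v) = Gqs L v` (`v` non-split, so `Z(G)` is compact, ★
`isCompact_center_Gqs`), `ρ` an irreducible smooth SUPERCUSPIDAL representation on `V` with a `G`-invariant sesquilinear form `B`, `v₁ ∈ V`, and the
coefficient `w(y) := B v₁ (ρ(y) v₁)` (`= conj u_{v₁}(y)` for Hermitian `B`, `u_{v₁}(y) = B (ρ y v₁) v₁`; census ERRATUM E1 convention).  Suppose the TRACE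
IDENTITY «(T2)» holds with a constant `a ≠ 0`:  `∫_x ∫_g φ(g) w(x g x⁻¹) dν dν = a · Tr ρ(φ)` for every `φ ∈ C_c^∞(G)` (★-to-be E2-2 (T2)
`Representation.IsSupercuspidal.integral_integral_mul_sesqForm_conj_eq`, `a = κ · B v₁ v₁`, LH5-p04 (g8)) and let `Θ = χ_π` be Harish-Chandra's character
(M1): locally constant on `G^r`, computing `Tr π`.  Then at every REGULAR `γ₀ ∉ Ω` (= ELLIPTIC regular: compact centraliser, ★ «ELL-CARTAN-COMPACT»):

  `∫_G w(x γ₀ x⁻¹) dν(x) = a · Θ(γ₀)`,  hence  `Φ^{can}(⟦γ₀⟧, (conj a)⁻¹ · u_{v₁}) = conj Θ(γ₀)`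

— i.e. `f_π := (conj a)⁻¹ · u_{v₁}` (`= (d∕‖v₁‖²)·u_{v₁}` when `a = d⁻¹ ‖v₁‖²`) satisfies the ELLIPTIC clause of ★ `Ch12Sec5.EllipticData.IsPseudoCoeff`
(`∀ γ ∈ G^e, Φ(γ, f) = conj χ_π(γ)`).  PROOF = ★-to-be LH5-p02 FILE 1 HEAD `eq_mul_integral_conj_of_forall_setIntegral_eq` (Fubini against `𝟙_C`, tube lemma,
compact-open shrink) fed with: (UC) ★-to-be LH5-p02 `exists_isOpen_isCompact_forall_apply_conj_eq_zero_cmDatum_local_of_isCompact_centralizer` (Harish-Chandra's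
uniform compactness at a `G`-neighbourhood of `γ₀`; inputs `Z(γ₀)` compact — ★ «ELL-CARTAN-COMPACT» — and `supp w` compact — ★ E2-1 A
`IsSupercuspidal.hasCompactSupport_sesqForm_apply_apply`, `Z(G)` compact); (LCχ) the (M1) local constancy of `Θ` at `γ₀`; (T2) at `φ = 𝟙_C` combined with
(M1) `Tr π(𝟙_C) = ∫_C Θ`.  The datum dress reads `𝔇.orbInt γ₀ f = Φ(⟦γ₀⟧, f) = ∫_G f(x γ₀ x⁻¹) dν` through COMPAT `𝔇.orb = mQv` (hC04) and the canonical
family's compact-centraliser reading ★ `OrbitalMeasureFamily.IsCanonical.classOrbitalIntegral_mk_eq_integral_conj_of_isCompact`.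

* §0 plumbing at `Gqs L v`: `locallyCompactSpace_GL_adicCompletion`, `secondCountableTopology_GL_adicCompletion` (the instance binders of the ★ uniform-compactness
  heads, discharged once and for all: `L_w` is a proper local field, ★ `properSpace_adicCompletion`), `isRegularElt_out_conjClassesMk` (regularity of the
  chosen representative of `⟦γ⟧`), `integral_conj_eq_classOrbitalIntegral` (the canonical reading at a regular `γ ∉ Ω`, `f` continuous).
* §1 MODEL level (datum-free): `integral_sesqForm_conj_eq_mul_of_trace_identity` — `∫_x B v₁ (ρ (x γ₀ x⁻¹) v₁) dν = a · Θ γ₀` from (T2)∘(M1)-at-indicators (hypothesis,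
  any `a ≠ 0`) and local constancy of `Θ` at `γ₀`; **`integral_sesqForm_conj_eq_kappa_mul_of_char`** — the same with (T2) DISCHARGED by ★ E2-2 (`a = κ · B v₁ v₁`): the
  consumer shape (D) of WANTS-E2-5 v1 (F0P3a-p02 (g26)) token for token.
* §2 DATUM dress: `orbInt_sesqForm_eq_mul_char_on_ellG` — at any §12.5 datum `𝔇` on `Gqs L v` with COMPAT `μG = νQv`, `orb = mQv`, `regG ↔ IsRegularElt`, the pin
  consequence `hEΩ : G^e ⊆ G^r ∖ Ω` and (M1∀) VERBATIM (the `hM1` binder of ★ PS-VANISH §2 ∕ ★ LDS-OPP): `∀ γ ∈ 𝔇.ellG, 𝔇.orbInt γ w = a · 𝔇.char π γ`.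
* §3 PSEUDO-COEFFICIENT NORMAL FORM: `orbInt_smul_matrixCoeff_eq_conj_char_on_ellG` — for Hermitian `B`: `∀ γ ∈ 𝔇.ellG, 𝔇.orbInt γ (fun y => (conj a)⁻¹ * B (ρ y v₁) v₁)
  = conj (𝔇.char π γ)` — the elliptic clause of `𝔇.IsPseudoCoeff π f_π` for `f_π = (conj a)⁻¹ • u_{v₁}`; consumer-in-waiting: E2-5 (P) «SC-PSEUDO-COEFF» (F0P3a-p06
  (g24)'s statement-first knock 22:10:29Z), with E2-3b (LH1-p01) supplying the hyperbolic clause and E2-2 (T1) the traces.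

## References
* [Rogawski1990] J. D. Rogawski, *Automorphic Representations of Unitary Groups in Three Variables*, Ann. of Math. Stud. 123 (1990): §12.6 p. 187; §12.5 p. 182, p. 184; §4.9 p. 54; §1.6 p. 5.
* [HarishChandra1970] Harish-Chandra (notes by G. van Dijk), *Harmonic analysis on reductive p-adic groups*, LNM 162 (1970), Part V §4, Lemma 23 and Theorem 12 (pp. 57–62).
-/

set_option autoImplicit false
-- the mandated namespace has the single-problem summit's repeated segment (`HodgeConjecture.HodgeConjecture`)
set_option linter.dupNamespace false

noncomputable section

open NumberField IsDedekindDomain MeasureTheory MeasureTheory.Measure Filter Topology TopologicalSpace Set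
open scoped Matrix MatrixGroups ComplexConjugate
open Literature.NumberTheory.Rogawski1990 Literature.NumberTheory.Automorphic Literature.NumberTheory.Automorphic.UnitaryGroup

namespace Summit.HodgeConjecture.HodgeConjecture.Cruxes.H413.F0P3cStCharTSScEllReading

open Literature.NumberTheory.Rogawski1990.Ch12Sec5
open Summit.HodgeConjecture.HodgeConjecture.Cruxes.H413.F0P3cStCharTSTorusDefs

/-! ## §0 Plumbing at `Gqs L v` -/

section Plumbing

variable (L : Type) [Field L] [NumberField L] [IsCMField L] (v : HeightOneSpectrum (𝓞 ↥(maximalRealSubfield L)))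

omit [IsCMField L] in
/-- `GL₃(L_w)` is locally compact (`L_w` a proper local field, ★ `locallyCompactSpace_adicCompletion`; the instance binder of the ★ uniform-compactness heads).
[cite: Rogawski1990, §4.9 p. 54] -/
theorem locallyCompactSpace_GL_adicCompletion (w : PlacesOver L v) : LocallyCompactSpace (GL (Fin 3) (w.1.adicCompletion L)) := by
  haveI : LocallyCompactSpace (w.1.adicCompletion L) := locallyCompactSpace_adicCompletion L w.1
  haveI : LocallyCompactSpace (Matrix (Fin 3) (Fin 3) (w.1.adicCompletion L)) :=
    inferInstanceAs (LocallyCompactSpace (Fin 3 → Fin 3 → w.1.adicCompletion L))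
  infer_instance

omit [IsCMField L] in
/-- `GL₃(L_w)` is second countable (`L_w` proper ⇒ second countable; units embed in `M₃ × M₃ᵐᵒᵖ`). [cite: Rogawski1990, §4.9 p. 54] -/
theorem secondCountableTopology_GL_adicCompletion (w : PlacesOver L v) : SecondCountableTopology (GL (Fin 3) (w.1.adicCompletion L)) := by
  haveI : ProperSpace (w.1.adicCompletion L) := properSpace_adicCompletion L w.1
  haveI : SecondCountableTopology (Matrix (Fin 3) (Fin 3) (w.1.adicCompletion L)) :=
    inferInstanceAs (SecondCountableTopology (Fin 3 → Fin 3 → w.1.adicCompletion L))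
  haveI : SecondCountableTopology (Matrix (Fin 3) (Fin 3) (w.1.adicCompletion L))ᵐᵒᵖ :=
    MulOpposite.opHomeomorph.symm.secondCountableTopology
  exact Units.isEmbedding_embedProduct.secondCountableTopology

/-- The chosen representative `out ⟦γ⟧` of the class of a regular `γ` is regular (it is conjugate to `γ`, ★ `isRegularElt_conj_iff`). [cite: Rogawski1990, §3.1 p. 19] -/
theorem isRegularElt_out_conjClassesMk (γ : Gqs L v) (hγ : IsRegularElt (γ.val : GL (Fin 3) (UnitaryGroup.LocalRing L v))) :
    IsRegularElt ((Quotient.out (ConjClasses.mk γ)).val : GL (Fin 3) (UnitaryGroup.LocalRing L v)) := by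
  have hmk : ConjClasses.mk (Quotient.out (ConjClasses.mk γ)) = ConjClasses.mk γ := by
    rw [← ConjClasses.quotient_mk_eq_mk, Quotient.out_eq]
  obtain ⟨c, hc⟩ := isConj_iff.1 (ConjClasses.mk_eq_mk_iff_isConj.1 hmk.symm)
  rw [← hc]
  exact (F0P3cStCharTSEllipticCriterion.isRegularElt_coe_conj_iff _ _ γ c).2 hγ

/-- **The canonical reading at a regular `γ` with COMPACT centraliser** (e.g. `γ ∉ Ω`, ★ «ELL-CARTAN-COMPACT»): for the canonical family `mQv` on the regular
classes and a CONTINUOUS `f`, `Φ(⟦γ⟧, f) = ∫_G f(x γ x⁻¹) dν` (★ compact-centraliser reading of a canonical family).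
[cite: Rogawski1990, §12.5 p. 184; §4.9 p. 54] -/
theorem integral_conj_eq_classOrbitalIntegral
    [MeasurableSpace (Gqs L v)] [BorelSpace (Gqs L v)]
    [∀ γ : Gqs L v, MeasurableSpace (Gqs L v ⧸ Subgroup.centralizer ({γ} : Set (Gqs L v)))]
    [∀ γ : Gqs L v, BorelSpace (Gqs L v ⧸ Subgroup.centralizer ({γ} : Set (Gqs L v)))]
    (νQv : Measure (Gqs L v)) [νQv.IsHaarMeasure] [νQv.IsMulRightInvariant]
    (mQv : OrbitalMeasureFamily (Gqs L v))
    (hcanQ : mQv.IsCanonical (fun γ => IsRegularElt (γ.val : GL (Fin 3) (UnitaryGroup.LocalRing L v))) νQv)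
    (γ : Gqs L v) (hγ : IsRegularElt (γ.val : GL (Fin 3) (UnitaryGroup.LocalRing L v)))
    (hZ : IsCompact ((Subgroup.centralizer ({γ} : Set (Gqs L v))) : Set (Gqs L v)))
    (f : Gqs L v → ℂ) (hf : Continuous f) :
    classOrbitalIntegral mQv f (ConjClasses.mk γ) = ∫ x, f (x * γ * x⁻¹) ∂νQv :=
  hcanQ.classOrbitalIntegral_mk_eq_integral_conj_of_isCompact γ (isRegularElt_out_conjClassesMk L v γ hγ) hZ f hf

end Plumbing

/-! ## §1 Model level: the orbital integral of a supercuspidal coefficient at a regular `γ₀ ∉ Ω` from the trace identity -/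

section Model

variable (L : Type) [Field L] [NumberField L] [IsCMField L] (v : HeightOneSpectrum (𝓞 ↥(maximalRealSubfield L)))

set_option maxHeartbeats 1600000 in
set_option synthInstance.maxHeartbeats 400000 in
/-- **«ELL-READING», MODEL LEVEL** on `G = U(Φ₃)(L⁺_v)` (`v` non-split).  `ρ` smooth irreducible SUPERCUSPIDAL (`r : SmoothIrrep G`), `B` a `G`-invariant
sesquilinear form on `V` (no symmetry ∕ positivity is used here), `v₁ ∈ V`, `w(y) := B v₁ (ρ y v₁)`; `Θ : G → ℂ` locally constant at `γ₀`; `a : ℂ`, `a ≠ 0`;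
the TRACE IDENTITY at indicators of compact open sets, already composed with the character relation:
`∫_x ∫_g 𝟙_C(g) w(x g x⁻¹) dν dν = a · ∫ 𝟙_C Θ dν` (= E2-2 (T2) «`… = κ · B v₁ v₁ · Tr ρ(𝟙_C)`» ∘ (M1) «`Tr π(𝟙_C) = ∫ 𝟙_C χ_π`»).  Then at every REGULAR
`γ₀` with COMPACT centraliser:  `∫_G B v₁ (ρ (x γ₀ x⁻¹) v₁) dν(x) = a · Θ(γ₀)`.  Proof: ★-to-be `eq_mul_integral_conj_of_forall_setIntegral_eq` with (UC) from ★-to-be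
`exists_isOpen_isCompact_forall_apply_conj_eq_zero_cmDatum_local_of_isCompact_centralizer` (compact support of `w`: ★ E2-1 A, `Z(G)` compact ★ `isCompact_center_Gqs`),
local constancy of `w` (smooth vector), of `Θ` (hypothesis), and `c := a⁻¹`.
[cite: Rogawski1990, §12.6 p. 187; §4.9 p. 54; §1.6 p. 5] [cite: HarishChandra1970, Part V §4 Lemma 23, Thm. 12 (pp. 57–62)] -/
theorem integral_sesqForm_conj_eq_mul_of_trace_identity
    (hns : ∀ w : PlacesOver L v, IsCMField.complexConj L • w.1 = w.1)
    [MeasurableSpace (Gqs L v)] [BorelSpace (Gqs L v)]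
    (νQv : Measure (Gqs L v)) [νQv.IsHaarMeasure]
    (r : SmoothIrrep (Gqs L v)) (hsc : r.ρ.IsSupercuspidal)
    (B : r.V →ₗ⋆[ℂ] r.V →ₗ[ℂ] ℂ) (hBinv : ∀ (g : Gqs L v) (x y : r.V), B (r.ρ g x) (r.ρ g y) = B x y) (v₁ : r.V)
    (Θ : Gqs L v → ℂ) (a : ℂ) (ha : a ≠ 0)
    (hT : ∀ C : Set (Gqs L v), IsCompact C → IsOpen C →
      ∫ x, (∫ g, C.indicator (fun _ => (1 : ℂ)) g * B v₁ (r.ρ (x * g * x⁻¹) v₁) ∂νQv) ∂νQv =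
        a * ∫ g, C.indicator (fun _ => (1 : ℂ)) g * Θ g ∂νQv)
    (γ₀ : Gqs L v) (hreg : IsRegularElt (γ₀.val : GL (Fin 3) (UnitaryGroup.LocalRing L v)))
    (hZ : IsCompact ((Subgroup.centralizer ({γ₀} : Set (Gqs L v))) : Set (Gqs L v)))
    (hΘ : ∀ᶠ y in 𝓝 γ₀, Θ y = Θ γ₀) :
    ∫ x, B v₁ (r.ρ (x * γ₀ * x⁻¹) v₁) ∂νQv = a * Θ γ₀ := by
  classical
  haveI : TotallyDisconnectedSpace (Gqs L v) := totallyDisconnectedSpace_cmDatum_local L 3 (qsForm L) v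
  -- the coefficient `w` and its regularity
  set w : Gqs L v → ℂ := fun y => B v₁ (r.ρ y v₁) with hw_def
  have hsm : r.ρ.IsSmooth := r.isSmooth
  have hwlc : IsLocallyConstant w := (hsm.isLocallyConstant_apply r.ρ v₁).comp (B v₁)
  have hZG : IsCompact ((Subgroup.center (Gqs L v) : Subgroup (Gqs L v)) : Set (Gqs L v)) :=
    F0P3cStCharTSParField.isCompact_center_Gqs L v hns
  have hwcs : HasCompactSupport w := hsc.hasCompactSupport_sesqForm_apply_apply hZG hsm hBinv v₁ v₁
  -- (UC) at a `G`-neighbourhood of `γ₀` (Harish-Chandra's uniform compactness, ★-to-be LH5-p02)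
  obtain ⟨w₀⟩ := (inferInstance : Nonempty (PlacesOver L v))
  haveI := locallyCompactSpace_GL_adicCompletion L v w₀
  haveI := secondCountableTopology_GL_adicCompletion L v w₀
  obtain ⟨C₁, hC₁o, hγC₁, S, hS, hCS⟩ :=
    exists_isOpen_isCompact_forall_apply_conj_eq_zero_cmDatum_local_of_isCompact_centralizer L 3 (qsForm L)
      (antidiagOne_isHermitian L 3) (isUnit_antidiagOne_det L 3) w₀ (hns w₀) γ₀ hreg hZ hwcs (subset_tsupport w)
  -- shrink to the constancy neighbourhood of `Θ`
  obtain ⟨O, hOΘ, hOo, hγO⟩ := _root_.mem_nhds_iff.1 hΘ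
  set C₀ : Set (Gqs L v) := C₁ ∩ O with hC₀_def
  have hC₀o : IsOpen C₀ := hC₁o.inter hOo
  have hγC₀ : γ₀ ∈ C₀ := ⟨hγC₁, hγO⟩
  have hCS₀ : ∀ g ∈ C₀, ∀ x : Gqs L v, x ∉ S → w (x * g * x⁻¹) = 0 := fun g hg x hx => hCS g hg.1 x hx
  have hχ : ∀ g ∈ C₀, Θ g = Θ γ₀ := fun g hg => hOΘ hg.2
  -- the tested trace identity, in set-integral form, with `c := a⁻¹`
  have hT' : ∀ C : Set (Gqs L v), C ⊆ C₀ → IsCompact C → IsOpen C → γ₀ ∈ C →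
      ∫ g in C, Θ g ∂νQv = a⁻¹ * ∫ x, ∫ g in C, w (x * g * x⁻¹) ∂νQv ∂νQv := by
    intro C _ hCc hCo _
    have h := hT C hCc hCo
    have hL : (fun x => ∫ g, C.indicator (fun _ => (1 : ℂ)) g * w (x * g * x⁻¹) ∂νQv) =
        fun x => ∫ g in C, w (x * g * x⁻¹) ∂νQv := by
      funext x
      rw [← integral_indicator hCo.measurableSet]
      congr 1
      funext g
      by_cases hg : g ∈ C
      · simp only [Set.indicator_of_mem hg, one_mul]
      · simp only [Set.indicator_of_notMem hg, zero_mul]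
    have hR : ∫ g, C.indicator (fun _ => (1 : ℂ)) g * Θ g ∂νQv = ∫ g in C, Θ g ∂νQv := by
      rw [← integral_indicator hCo.measurableSet]
      congr 1
      funext g
      by_cases hg : g ∈ C
      · simp only [Set.indicator_of_mem hg, one_mul]
      · simp only [Set.indicator_of_notMem hg, zero_mul]
    rw [hL, hR] at h
    rw [h, ← mul_assoc, inv_mul_cancel₀ ha, one_mul]
  have hmain := eq_mul_integral_conj_of_forall_setIntegral_eq νQv hwlc hC₀o hγC₀ hS hCS₀ hχ hT'
  -- `Θ γ₀ = a⁻¹ · ∫ w(x γ₀ x⁻¹)` ⇒ the claim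
  rw [hmain, ← mul_assoc, mul_inv_cancel₀ ha, one_mul]

set_option maxHeartbeats 1600000 in
set_option synthInstance.maxHeartbeats 400000 in
/-- **«ELL-READING», MODEL LEVEL, (T2) DISCHARGED — the E2-5 consumer shape (D) of WANTS-E2-5 v1 (F0P3a-p02 (g26), 0454b11568b3db9d) token for token.**
`ρ` irreducible ADMISSIBLE SUPERCUSPIDAL on `U(Φ₃)(L⁺_v)` (`v` non-split), `B` an invariant positive-definite Hermitian form, `νQv` Haar and inversion-invariant,
`v₀ ≠ 0` (Schur's normalising vector), `v₁ ≠ 0`; `Θ : G → ℂ` computing `Tr ρ` on `C_c^∞(G)` and locally constant at `γ₀`; `γ₀` regular with COMPACT centraliser.  Then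
`∫_G B v₁ (ρ (x γ₀ x⁻¹) v₁) dν(x) = κ · B v₁ v₁ · Θ(γ₀)`, `κ = (∫ ‖B (ρ x v₀) v₀‖² dν) ∕ (re B v₀ v₀)²` — §1 fed with ★ E2-2 (T2)
`Representation.IsSupercuspidal.integral_integral_mul_sesqForm_conj_eq` at `φ = 𝟙_C` (`a = κ · B v₁ v₁ ≠ 0` by ★ E2-1 `integral_norm_sq_sesqForm_pos` and `hBpos`).
[cite: Rogawski1990, §12.6 p. 187; §1.6 p. 5] [cite: HarishChandra1970, Part V §4 Thm. 12 (pp. 57–62); Part I §1 Theorem 1 (a)] -/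
theorem integral_sesqForm_conj_eq_kappa_mul_of_char
    (hns : ∀ w : PlacesOver L v, IsCMField.complexConj L • w.1 = w.1)
    [MeasurableSpace (Gqs L v)] [BorelSpace (Gqs L v)]
    (νQv : Measure (Gqs L v)) [νQv.IsHaarMeasure] [νQv.IsInvInvariant]
    (r : SmoothIrrep (Gqs L v)) (hadm : r.ρ.IsAdmissible) (hsc : r.ρ.IsSupercuspidal)
    (B : r.V →ₗ⋆[ℂ] r.V →ₗ[ℂ] ℂ) (hBsymm : B.IsSymm) (hBpos : ∀ x : r.V, x ≠ 0 → 0 < (B x x).re)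
    (hBinv : ∀ (g : Gqs L v) (x y : r.V), B (r.ρ g x) (r.ρ g y) = B x y)
    {v₀ : r.V} (hv₀ : v₀ ≠ 0) {v₁ : r.V} (hv₁ : v₁ ≠ 0)
    (Θ : Gqs L v → ℂ) (hΘtr : ∀ φ ∈ SchwartzBruhat (Gqs L v), r.ρ.smoothTrace νQv φ = ∫ g, φ g * Θ g ∂νQv)
    (γ₀ : Gqs L v) (hreg : IsRegularElt (γ₀.val : GL (Fin 3) (UnitaryGroup.LocalRing L v)))
    (hZ : IsCompact ((Subgroup.centralizer ({γ₀} : Set (Gqs L v))) : Set (Gqs L v)))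
    (hΘlc : ∀ᶠ y in 𝓝 γ₀, Θ y = Θ γ₀) :
    ∫ x, B v₁ (r.ρ (x * γ₀ * x⁻¹) v₁) ∂νQv =
      (((∫ x, ‖B (r.ρ x v₀) v₀‖ ^ 2 ∂νQv) / (B v₀ v₀).re ^ 2 : ℝ) : ℂ) * B v₁ v₁ * Θ γ₀ := by
  haveI : NonarchimedeanGroup (Gqs L v) :=
    nonarchimedeanGroup_unitaryGroupOfForm_local (E := L) (c := IsCMField.complexConj L) (N := 3) (v := v)
      (J' := (adelicForm L 3 (qsForm L)).map (adeleToLocal L v))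
  have hZG : IsCompact ((Subgroup.center (Gqs L v) : Subgroup (Gqs L v)) : Set (Gqs L v)) :=
    F0P3cStCharTSParField.isCompact_center_Gqs L v hns
  -- the constant `a := κ · B v₁ v₁ ≠ 0`
  have hκ : 0 < (∫ x, ‖B (r.ρ x v₀) v₀‖ ^ 2 ∂νQv) / (B v₀ v₀).re ^ 2 :=
    div_pos (hsc.integral_norm_sq_sesqForm_pos hZG r.isSmooth hBsymm hBpos hBinv νQv hv₀) (pow_pos (hBpos v₀ hv₀) 2)
  have hB₁ : B v₁ v₁ ≠ 0 := fun h => by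
    have h' := hBpos v₁ hv₁
    rw [h, Complex.zero_re] at h'
    exact lt_irrefl _ h'
  have ha : ((((∫ x, ‖B (r.ρ x v₀) v₀‖ ^ 2 ∂νQv) / (B v₀ v₀).re ^ 2 : ℝ) : ℂ) * B v₁ v₁) ≠ 0 :=
    mul_ne_zero (Complex.ofReal_ne_zero.2 hκ.ne') hB₁
  rw [show ((((∫ x, ‖B (r.ρ x v₀) v₀‖ ^ 2 ∂νQv) / (B v₀ v₀).re ^ 2 : ℝ) : ℂ) * B v₁ v₁ * Θ γ₀) =
      ((((∫ x, ‖B (r.ρ x v₀) v₀‖ ^ 2 ∂νQv) / (B v₀ v₀).re ^ 2 : ℝ) : ℂ) * B v₁ v₁) * Θ γ₀ from rfl]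
  refine integral_sesqForm_conj_eq_mul_of_trace_identity L v hns νQv r hsc B hBinv v₁ Θ _ ha (fun C hCc hCo => ?_) γ₀ hreg hZ hΘlc
  have hφ : (C.indicator fun _ => (1 : ℂ)) ∈ SchwartzBruhat (Gqs L v) :=
    (mem_schwartzBruhat_iff).2 ((isLocSmooth_iff _).1 (isLocSmooth_indicator hCo hCc.isClosed hCc))
  rw [hsc.integral_integral_mul_sesqForm_conj_eq hadm hZG hBsymm hBpos hBinv νQv hφ hv₀ v₁, hΘtr _ hφ, mul_assoc]

end Model

/-! ## §2 Datum dress: `Φ(γ, w) = a · χ_π(γ)` on `G^e` -/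

section Datum

variable (L : Type) [Field L] [NumberField L] [IsCMField L] (v : HeightOneSpectrum (𝓞 ↥(maximalRealSubfield L)))

set_option maxHeartbeats 1600000 in
set_option synthInstance.maxHeartbeats 400000 in
/-- **«ELL-READING» AT A §12.5 DATUM** `𝔇` on `U(Φ₃)(L⁺_v)` (`v` non-split) with COMPAT `𝔇.μG = νQv` (hC01), `𝔇.orb = mQv` (hC04), `regG ↔ IsRegularElt` (hC05), the
pin consequence `hEΩ : G^e ⊆ G^r ∖ Ω` (★ «ELL-FIELD») and (M1∀) = Harish-Chandra regularity for EVERY class [§1.6 p. 5] (the `hM1` binder of ★ PS-VANISH §2 ∕ ★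
LDS-OPP, token for token).  For `π = [ρ]` the class of a smooth irreducible SUPERCUSPIDAL `ρ` with an invariant sesquilinear form `B`, `v₁ ∈ V`, `a ≠ 0` and the
trace identity (T2) «`∫_x ∫_g φ(g) B v₁ (ρ(x g x⁻¹) v₁) = a · Tr π(φ)` for every `φ ∈ C_c^∞(G)`» (★-to-be E2-2, `a = κ · B v₁ v₁`):
**`∀ γ ∈ G^e, Φ(γ, y ↦ B v₁ (ρ y v₁)) = a · χ_π(γ)`.**  (§1 at `Θ := χ_π`, plus the canonical reading §0.)
[cite: Rogawski1990, §12.6 p. 187; §12.5 pp. 182–184; §1.6 p. 5] [cite: HarishChandra1970, Part V §4 Thm. 12 (pp. 57–62)] -/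
theorem orbInt_sesqForm_eq_mul_char_on_ellG
    (hns : ∀ w : PlacesOver L v, IsCMField.complexConj L • w.1 = w.1)
    [MeasurableSpace (Gqs L v)] [BorelSpace (Gqs L v)]
    [∀ γ : Gqs L v, MeasurableSpace (Gqs L v ⧸ Subgroup.centralizer ({γ} : Set (Gqs L v)))]
    [∀ γ : Gqs L v, BorelSpace (Gqs L v ⧸ Subgroup.centralizer ({γ} : Set (Gqs L v)))]
    [MeasurableSpace (Gqs L v ⧸ Subgroup.center (Gqs L v))]
    {H : Type} [Group H] [TopologicalSpace H] [IsTopologicalGroup H] [MeasurableSpace H]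
    (νQv : Measure (Gqs L v)) [νQv.IsHaarMeasure] [νQv.IsMulRightInvariant]
    (mQv : OrbitalMeasureFamily (Gqs L v))
    (hcanQ : mQv.IsCanonical (fun γ => IsRegularElt (γ.val : GL (Fin 3) (UnitaryGroup.LocalRing L v))) νQv)
    (𝔇 : EllipticData (Gqs L v) H)
    -- ══ COMPAT (three of the seven clauses of the (S-𝔇) package: hC01, hC04, hC05) ══
    (hμG : 𝔇.μG = νQv) (horb : 𝔇.orb = mQv)
    (hreg : ∀ γ : Gqs L v, γ ∈ 𝔇.regG ↔ IsRegularElt (γ.val : GL (Fin 3) (UnitaryGroup.LocalRing L v)))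
    -- ══ the elliptic set sits inside `G^r ∖ Ω` (slice S2's pin `hE`, forward direction) ══
    (hEΩ : ∀ γ ∈ 𝔇.ellG, IsRegularElt (γ.val : GL (Fin 3) (UnitaryGroup.LocalRing L v)) ∧ γ ∉ hyperbolicSet L v)
    -- ══ (M1∀): Harish-Chandra regularity of `χ_π` for EVERY class (verbatim `hchar`) ══
    (hM1 : ∀ π : IrrClass (Gqs L v), Measurable (𝔇.char π) ∧ LocallyIntegrable (𝔇.char π) 𝔇.μG ∧
      (∀ x ∈ 𝔇.regG, ∀ᶠ y in 𝓝 x, 𝔇.char π y = 𝔇.char π x) ∧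
      ∀ φ : Gqs L v → ℂ, IsLocSmooth φ → π.smoothTrace 𝔇.μG φ = ∫ x, φ x * 𝔇.char π x ∂𝔇.μG)
    -- ══ the supercuspidal representation, its invariant form, the vector, and the trace identity (T2) BY SHAPE ══
    (r : SmoothIrrep (Gqs L v)) (hsc : r.ρ.IsSupercuspidal)
    (B : r.V →ₗ⋆[ℂ] r.V →ₗ[ℂ] ℂ) (hBinv : ∀ (g : Gqs L v) (x y : r.V), B (r.ρ g x) (r.ρ g y) = B x y) (v₁ : r.V)
    (a : ℂ) (ha : a ≠ 0)
    (hT2 : ∀ φ : Gqs L v → ℂ, IsLocSmooth φ →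
      ∫ x, (∫ g, φ g * B v₁ (r.ρ (x * g * x⁻¹) v₁) ∂νQv) ∂νQv = a * (IrrClass.mk r).smoothTrace νQv φ) :
    ∀ γ ∈ 𝔇.ellG, 𝔇.orbInt γ (fun y => B v₁ (r.ρ y v₁)) = a * 𝔇.char (IrrClass.mk r) γ := by
  intro γ hγ
  obtain ⟨hγreg, hγΩ⟩ := hEΩ γ hγ
  obtain ⟨-, -, hlc, htr⟩ := hM1 (IrrClass.mk r)
  -- continuity of the coefficient (smooth vector)
  have hwc : Continuous fun y => B v₁ (r.ρ y v₁) := Representation.continuous_sesqForm_apply_apply (r.isSmooth v₁) v₁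
  -- compact centraliser (★ «ELL-CARTAN-COMPACT») and the datum's orbital integral as a group integral
  have hZ : IsCompact ((Subgroup.centralizer ({γ} : Set (Gqs L v))) : Set (Gqs L v)) :=
    F0P3cStCharTSEllCartanCompact.isCompact_centralizer_of_not_mem_hyperbolicSet L v hns hγreg hγΩ
  have horbInt : 𝔇.orbInt γ (fun y => B v₁ (r.ρ y v₁)) = ∫ x, B v₁ (r.ρ (x * γ * x⁻¹) v₁) ∂νQv := by
    rw [EllipticData.orbInt, horb]
    exact integral_conj_eq_classOrbitalIntegral L v νQv mQv hcanQ γ hγreg hZ _ hwc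
  rw [horbInt]
  -- §1 with `Θ := χ_π`: the trace identity at indicators, composed with (M1)
  refine integral_sesqForm_conj_eq_mul_of_trace_identity L v hns νQv r hsc B hBinv v₁ (𝔇.char (IrrClass.mk r)) a ha
    (fun C hCc hCo => ?_) γ hγreg hZ (hlc γ ((hreg γ).2 hγreg))
  have hφ : IsLocSmooth (C.indicator fun _ => (1 : ℂ)) := isLocSmooth_indicator hCo hCc.isClosed hCc
  rw [hT2 _ hφ, ← hμG, htr _ hφ]

end Datum

/-! ## §3 The pseudo-coefficient normal form: `Φ(γ, (conj a)⁻¹ · u_{v₁}) = conj χ_π(γ)` on `G^e` -/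

section PseudoCoeff

variable (L : Type) [Field L] [NumberField L] [IsCMField L] (v : HeightOneSpectrum (𝓞 ↥(maximalRealSubfield L)))

set_option maxHeartbeats 1600000 in
set_option synthInstance.maxHeartbeats 400000 in
/-- **THE ELLIPTIC CLAUSE OF `IsPseudoCoeff` FOR A SUPERCUSPIDAL MATRIX COEFFICIENT.**  Same frame as `orbInt_sesqForm_eq_mul_char_on_ellG`, `B` moreover
HERMITIAN (`B.IsSymm`, so `B (ρ y v₁) v₁ = conj (B v₁ (ρ y v₁)) = u_{v₁}(y)`).  With `f_π := fun y => (conj a)⁻¹ * B (ρ y v₁) v₁` (for the E2-2 constant `a = κ · B v₁ v₁`,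
real and positive, this is print's `f_π = d(π) ‖v₁‖⁻² · u_{v₁}`):  **`∀ γ ∈ G^e, Φ(γ, f_π) = conj χ_π(γ)`** — the third clause of ★ `Ch12Sec5.EllipticData.IsPseudoCoeff π f_π`
(Ch12Sec5Defs :273), i.e. census HC-SC §2 E2-4 AS NEEDED.  [cite: Rogawski1990, §12.6 p. 187; §12.5 pp. 182–184] [cite: HarishChandra1970, Part V §4 Thm. 12 (pp. 57–62)] -/
theorem orbInt_smul_matrixCoeff_eq_conj_char_on_ellG
    (hns : ∀ w : PlacesOver L v, IsCMField.complexConj L • w.1 = w.1)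
    [MeasurableSpace (Gqs L v)] [BorelSpace (Gqs L v)]
    [∀ γ : Gqs L v, MeasurableSpace (Gqs L v ⧸ Subgroup.centralizer ({γ} : Set (Gqs L v)))]
    [∀ γ : Gqs L v, BorelSpace (Gqs L v ⧸ Subgroup.centralizer ({γ} : Set (Gqs L v)))]
    [MeasurableSpace (Gqs L v ⧸ Subgroup.center (Gqs L v))]
    {H : Type} [Group H] [TopologicalSpace H] [IsTopologicalGroup H] [MeasurableSpace H]
    (νQv : Measure (Gqs L v)) [νQv.IsHaarMeasure] [νQv.IsMulRightInvariant]
    (mQv : OrbitalMeasureFamily (Gqs L v))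
    (hcanQ : mQv.IsCanonical (fun γ => IsRegularElt (γ.val : GL (Fin 3) (UnitaryGroup.LocalRing L v))) νQv)
    (𝔇 : EllipticData (Gqs L v) H)
    (hμG : 𝔇.μG = νQv) (horb : 𝔇.orb = mQv)
    (hreg : ∀ γ : Gqs L v, γ ∈ 𝔇.regG ↔ IsRegularElt (γ.val : GL (Fin 3) (UnitaryGroup.LocalRing L v)))
    (hEΩ : ∀ γ ∈ 𝔇.ellG, IsRegularElt (γ.val : GL (Fin 3) (UnitaryGroup.LocalRing L v)) ∧ γ ∉ hyperbolicSet L v)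
    (hM1 : ∀ π : IrrClass (Gqs L v), Measurable (𝔇.char π) ∧ LocallyIntegrable (𝔇.char π) 𝔇.μG ∧
      (∀ x ∈ 𝔇.regG, ∀ᶠ y in 𝓝 x, 𝔇.char π y = 𝔇.char π x) ∧
      ∀ φ : Gqs L v → ℂ, IsLocSmooth φ → π.smoothTrace 𝔇.μG φ = ∫ x, φ x * 𝔇.char π x ∂𝔇.μG)
    (r : SmoothIrrep (Gqs L v)) (hsc : r.ρ.IsSupercuspidal)
    (B : r.V →ₗ⋆[ℂ] r.V →ₗ[ℂ] ℂ) (hBsymm : B.IsSymm) (hBinv : ∀ (g : Gqs L v) (x y : r.V), B (r.ρ g x) (r.ρ g y) = B x y) (v₁ : r.V)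
    (a : ℂ) (ha : a ≠ 0)
    (hT2 : ∀ φ : Gqs L v → ℂ, IsLocSmooth φ →
      ∫ x, (∫ g, φ g * B v₁ (r.ρ (x * g * x⁻¹) v₁) ∂νQv) ∂νQv = a * (IrrClass.mk r).smoothTrace νQv φ) :
    ∀ γ ∈ 𝔇.ellG, 𝔇.orbInt γ (fun y => (conj a)⁻¹ * B (r.ρ y v₁) v₁) = conj (𝔇.char (IrrClass.mk r) γ) := by
  intro γ hγ
  obtain ⟨hγreg, hγΩ⟩ := hEΩ γ hγ
  have hw := orbInt_sesqForm_eq_mul_char_on_ellG L v hns νQv mQv hcanQ 𝔇 hμG horb hreg hEΩ hM1 r hsc B hBinv v₁ a ha hT2 γ hγ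
  -- both functions are continuous; read both orbital integrals as group integrals
  have hwc : Continuous fun y => B v₁ (r.ρ y v₁) := Representation.continuous_sesqForm_apply_apply (r.isSmooth v₁) v₁
  have huc : Continuous fun y => B (r.ρ y v₁) v₁ := Representation.continuous_sesqForm_apply_apply' hBsymm (r.isSmooth v₁) v₁
  have hfc : Continuous fun y => (conj a)⁻¹ * B (r.ρ y v₁) v₁ := continuous_const.mul huc
  have hZ : IsCompact ((Subgroup.centralizer ({γ} : Set (Gqs L v))) : Set (Gqs L v)) :=
    F0P3cStCharTSEllCartanCompact.isCompact_centralizer_of_not_mem_hyperbolicSet L v hns hγreg hγΩ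
  rw [EllipticData.orbInt, horb, integral_conj_eq_classOrbitalIntegral L v νQv mQv hcanQ γ hγreg hZ _ hwc] at hw
  rw [EllipticData.orbInt, horb, integral_conj_eq_classOrbitalIntegral L v νQv mQv hcanQ γ hγreg hZ _ hfc]
  -- `B (ρ y v₁) v₁ = conj (B v₁ (ρ y v₁))`
  have hconj : (fun x : Gqs L v => (conj a)⁻¹ * B (r.ρ (x * γ * x⁻¹) v₁) v₁) =
      fun x => (conj a)⁻¹ * conj (B v₁ (r.ρ (x * γ * x⁻¹) v₁)) := by
    funext x
    rw [← hBsymm.eq v₁ (r.ρ (x * γ * x⁻¹) v₁)]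
  rw [hconj, integral_const_mul, integral_conj, hw, map_mul, ← mul_assoc, inv_mul_cancel₀ ((map_ne_zero _).2 ha), one_mul]

end PseudoCoeff

end Summit.HodgeConjecture.HodgeConjecture.Cruxes.H413.F0P3cStCharTSScEllReading

end
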